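import Summits.BirchSwinnertonDyer.BirchSwinnertonDyer.Theorems.EisensteinPrimesBSDpOnCellCTelescopeK2PurityFactFree
import Summits.BirchSwinnertonDyer.BirchSwinnertonDyer.Theorems.EisensteinPrimesBSDpOnCellCTelescopeK2FibreCofinite
import Summits.BirchSwinnertonDyer.BirchSwinnertonDyer.Theorems.EisensteinPrimesBSDpOnCellCTelescopeK2BigRepUnramified
import Summits.BirchSwinnertonDyer.BirchSwinnertonDyer.Theorems.EisensteinPrimesTwistDeformationFullAtSelmerOfFacts
import HarnessLib

/-!
# Route G′ for W4⁰, DOCKED at the W4⁰c road data: the residual is exactly the four LOCAL rows (e)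

Helper for crux 4 `BSDpOnCellC` of route `EisensteinPrimes`, line «telescope» (LEAD cruxlead-19034; v12 registered,
v13 announced), node W4⁰ = `K2Weight2.stub_bigPseudoNullPTorsion` / v13 `stub_weightTwoPseudoNullOfPub` (W4⁰c):
«every pseudo-null `B`-submodule of `X₂ = XBig κ ρ₂ 𝔭̄ ∅` is `p`-power torsion», `B = ℤ_p⟦X⟧⟦T⟧ = IwasawaAlgebra₂ p`,
`𝐃 = BigRepModule(A₂)`.  It closes NOTHING registered: no summit statement, no crux, no registered stub.

WHAT THIS FILE DOES.  The fact-free endpoint of route G′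
(`TelescopeK2PurityFactFree.forall_isPseudoNull_XBig_exists_pow_smul_eq_zero_factFree`, ideator g40 #2) displays,
besides (cof) and the LOCAL Galois rows, a handful of elementary inputs in Greenberg's currency: `p`-primarity of `A₂`,
`K` totally complex with one complex place, `𝔮 = 𝔭̄` of degree one over `ℤ`, the index set `Σ₀`, `s ≠ 0`.  Here they
are discharged from the data in which W4⁰c is actually stated (the road-R-β prefix and the fibre data FD⁺ of the
member-control node N1):
* `p`-primarity of `A₂` ⇐ (fd₀) «`A₂` is `X`-power torsion with a `C`-linear `θ₀ : A₂[X] → P` into a `p`-primary group,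
  finite kernel» (tree: `TelescopeK2FibreCofinite.exists_C_pow_smul_eq_zero_of_fd`, g38, +
  `TelescopeK2PurityOfProp411OfCofree.pPrimary_of_C_pow_smul_eq_zero`, g40 #1);
* `∀ v, v.IsComplex` and `r₂ = 1` ⇐ `IsImaginaryQuadratic K` (tree:
  `GreenbergFullAtSelmer.nrComplexPlaces_eq_one_of_isImaginaryQuadratic`);
* `e·f(𝔭̄ ∣ p) = 1` and «the primes above `p` are `𝔭`, `𝔭̄`» ⇐ `[K:ℚ] = 2`, `𝔭 ≠ 𝔭̄` above `p` (tree: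
  `GreenbergFullAtSelmer.ncard_primesOver_eq_two_and_deg_one_of_ne`, `eq_or_eq_of_natCast_mem_of_ne`);
* `Σ₀ := ∅`, so the LOC⁽¹⁾ row «at the no-index places `w ≠ 𝔭̄` with `p ∈ w ∨ w ∈ Σ₀`» is LOC⁽¹⁾ at `𝔭` alone;
* (reg₀) `¬ C X ∣ s` ⇒ `s ≠ 0`;
* (§2) `ramificationSubgroup K S ≤ ker` ⇐ «`ρ₂` unramified outside `S₀`», `S ⊇ S₀ ∪ {w ∣ p}` (tree:
  `TelescopeK2BigRepUnramified.ramificationSubgroup_le_ker_anticyclotomicBigGaloisRep`, g38).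

RESULT (`forall_isPseudoNull_XBig_exists_pow_smul_eq_zero_docked`, and its `S₀`-form `…_of_isUnramifiedOutside`):
for `K` imaginary quadratic, `p = 𝔭𝔭̄` split, `ρ₂` on a discrete `ℤ_p⟦X⟧`-cofree `A₂` with (fd₀), `S` finite
`⊇ {w ∣ p}` with `N_S ≤ ker (A₂ ⊗ Λ^*(Ψ⁻¹))`, and `X₂` killed by some `s ∉ (C X)`:
    LOC⁽¹⁾_𝔭(𝐃) → LOC⁽¹⁾_𝔭̄(𝐃) → corank_B H⁰(K_𝔭̄, 𝐃) = 0 → (∀ w ∈ S, w ∤ p → H¹(K_w, 𝐃) is B-cotorsion) →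
    every pseudo-null `B`-submodule of `X₂` is `p`-power torsion.
So, in the by-name currency of the telescope line: W4⁰c (with the instance binder `[IsTopologicalRing B]`, see below)
follows from THE FOUR LOCAL ROWS (e1) at `𝔭`, (e1) at `𝔭̄`, (e2), (e3) for `𝐃 = BigRepModule(A₂)` and nothing else
(width x2-p2 g22's offer, `pub/bsd-eis/STATUS.md` 2026-08-30 06:45Z; their determinant file
`…TelescopeK2BigRepDeterminant` is the algebra under (e1)/(e2)).

INSTANCE NOTE.  Like every Greenberg-side tree theorem (Literature `Greenberg2016.*`, `Greenberg2006.*`: sections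
`variable [IsTopologicalRing Λ]`), the theorems here carry `[IsTopologicalRing (IwasawaAlgebra₂ p)]`; `B`'s topology is
not definitionally phantom in `XBig` (Mathlib's `TopRep B G` over `TopModuleCat B`), so a W4⁰c quantifying over an
arbitrary `[TopologicalSpace B] [ContinuousSMul B 𝐃]` needs that binder too (ideator g40, bsd-eis INBOX 06:53:59Z).

HONEST FRAMING: THEOREMS ONLY; no `def`, no named fact, no `sorry`; nothing registered is closed; the LOCAL rows (e)
stay displayed; BSD is proved for no curve here.

References: [Greenberg2016Selmer] R. Greenberg, *On the structure of Selmer groups*, 2016, Prop. 4.1.1 (c) (p. 15);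
[Greenberg2006] R. Greenberg, *On the structure of certain Galois cohomology groups*, Doc. Math. Extra Vol. Coates
(2006) 335–391, Props. 3.1–3.2 (p. 358), 4.1–4.2 (pp. 367–368), §5 A (p. 373); [Greenberg2010] R. Greenberg,
*Surjectivity of the global-to-local map defining a Selmer group*, Kyoto J. Math. 50 (2010), Lemma 5.2.2;
[Castella2018Erratum] F. Castella, Erratum to *On the exceptional specializations of big Heegner points*, §2
(`X₂ = XBig`); [NeukirchANT1999] J. Neukirch, *Algebraic Number Theory*, Ch. I (8.2)–(8.4) (fundamental identity).
-/

set_option linter.dupNamespace false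
set_option autoImplicit false

noncomputable section

open Function
open Field IsDedekindDomain NumberField IsLocalRing PowerSeries
open Literature.NumberTheory.GaloisRepresentations Literature.NumberTheory.EllipticCurves
open Literature.NumberTheory.EllipticCurves.BigGaloisRep Literature.NumberTheory.IwasawaTheory
open Literature.NumberTheory.IwasawaTheory.Greenberg2016 Literature.NumberTheory.IwasawaTheory.Greenberg2006
open Summit.BirchSwinnertonDyer.BirchSwinnertonDyer.Theorems.GreenbergFullAtSelmer
open scoped NumberField

namespace Summit.BirchSwinnertonDyer.BirchSwinnertonDyer.Theorems.TelescopeK2PurityDocked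

variable {K : Type} [Field K] [NumberField K] (p : ℕ) [Fact p.Prime]
  {A : Type} [AddCommGroup A] [Module (IwasawaAlgebra p) A] [TopologicalSpace A] [DiscreteTopology A]
  [TopologicalSpace (IwasawaAlgebra p)] [TopologicalSpace (IwasawaAlgebra₂ p)]
  [IsTopologicalRing (IwasawaAlgebra₂ p)]
  [ContinuousSMul (IwasawaAlgebra₂ p) (BigRepModule (IwasawaAlgebra p) p A)]

/-! ## §1. The elementary inputs from the road data -/

omit [TopologicalSpace A] [DiscreteTopology A] [TopologicalSpace (IwasawaAlgebra p)]
  [TopologicalSpace (IwasawaAlgebra₂ p)] [IsTopologicalRing (IwasawaAlgebra₂ p)]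
  [ContinuousSMul (IwasawaAlgebra₂ p) (BigRepModule (IwasawaAlgebra p) p A)] in
/-- **(fd₀) ⇒ `A₂` is `p`-primary**: `X`-power torsion plus a `C`-linear `θ₀ : A₂[X] → P` into a `p`-primary group with
finite kernel. [cite: Greenberg2006, §3 A (proof of Prop. 3.1, p. 358 L19–21)] -/
theorem pPrimary_of_fd {P : Type*} [AddCommGroup P] [Module ℤ_[p] P]
    (hP : ∀ y : P, ∃ k : ℕ, ((p : ℤ_[p]) ^ k) • y = 0)
    (htor : ∀ a : A, ∃ n : ℕ, (X : PowerSeries ℤ_[p]) ^ n • a = 0)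
    (θ₀ : Submodule.torsionBy (PowerSeries ℤ_[p]) A (X : PowerSeries ℤ_[p]) →+ P)
    (hθ : ∀ (c : ℤ_[p]) (a : Submodule.torsionBy (PowerSeries ℤ_[p]) A (X : PowerSeries ℤ_[p])),
      θ₀ (C c • a) = c • θ₀ a)
    (hker : Finite θ₀.ker) : ∀ a : A, ∃ k : ℕ, p ^ k • a = 0 :=
  TelescopeK2PurityOfProp411OfCofree.pPrimary_of_C_pow_smul_eq_zero p
    fun a ↦ TelescopeK2FibreCofinite.exists_C_pow_smul_eq_zero_of_fd hP htor θ₀ hθ hker a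

omit [TopologicalSpace (IwasawaAlgebra p)] [TopologicalSpace (IwasawaAlgebra₂ p)] [IsTopologicalRing (IwasawaAlgebra₂ p)] in
/-- (reg₀) ⇒ (tor): an `s ∉ (C X)` is non-zero. [folklore] -/
theorem ne_zero_of_not_C_X_dvd {s : IwasawaAlgebra₂ p}
    (hs : ¬ (C (X : IwasawaAlgebra p) : IwasawaAlgebra₂ p) ∣ s) : s ≠ 0 := by
  rintro rfl
  exact hs (dvd_zero _)

/-! ## §2. The docked endpoint: W4⁰ from the four LOCAL rows (e) -/

/-- **W4⁰ for `X₂ = XBig κ ρ₂ 𝔭̄ ∅`, DOCKED: from the four LOCAL rows (e) alone.**  `K` imaginary quadratic, `p = 𝔭𝔭̄`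
split (`𝔭 ≠ 𝔭̄` above `p`), `ρ₂` on a discrete `ℤ_p⟦X⟧`-COFREE `A₂` with (fd₀) (`X`-power torsion, `θ₀` into a
`p`-primary `P` with finite kernel), `S` finite `⊇ {w ∣ p}` with `N_S ≤ ker (A₂ ⊗ Λ^*(Ψ⁻¹))`, `X₂` killed by some
`s ∉ (C X)`; then LOC⁽¹⁾ at `𝔭` and at `𝔭̄`, `corank_B H⁰(K_𝔭̄, 𝐃) = 0` and `B`-cotorsion of `H¹(K_w, 𝐃)` at the
`w ∈ S` prime to `p` give: every pseudo-null `B`-submodule of `X₂` is `p`-power torsion.  NO named fact; the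
Greenberg 2006/2016 inputs and Poitou–Tate are tree theorems (via `TelescopeK2PurityFactFree`).
[cite: Greenberg2016Selmer, Prop. 4.1.1 (c) p. 15, §2.3 p. 7 L1–17] [cite: Greenberg2006, Props. 4.1, 4.2 (pp. 367–368), §5 A (p. 373)]
[cite: Greenberg2010, Lemma 5.2.2] [cite: Castella2018Erratum, §2] [cite: NeukirchANT1999, Ch. I (8.2)] -/
theorem forall_isPseudoNull_XBig_exists_pow_smul_eq_zero_docked (hK : IsImaginaryQuadratic K)
    (κ : ZpExtension K p) (ρ : ContinuousRep (absoluteGaloisGroup K) (IwasawaAlgebra p) A)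
    (hcof : IsCofree (IwasawaAlgebra p) A)
    {P : Type*} [AddCommGroup P] [Module ℤ_[p] P] (hP : ∀ y : P, ∃ k : ℕ, ((p : ℤ_[p]) ^ k) • y = 0)
    (htor : ∀ a : A, ∃ n : ℕ, (X : PowerSeries ℤ_[p]) ^ n • a = 0)
    (θ₀ : Submodule.torsionBy (PowerSeries ℤ_[p]) A (X : PowerSeries ℤ_[p]) →+ P)
    (hθ : ∀ (c : ℤ_[p]) (a : Submodule.torsionBy (PowerSeries ℤ_[p]) A (X : PowerSeries ℤ_[p])),
      θ₀ (C c • a) = c • θ₀ a)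
    (hker : Finite θ₀.ker)
    (S : Set (HeightOneSpectrum (𝓞 K))) (hSf : S.Finite)
    (hSp : ∀ v : HeightOneSpectrum (𝓞 K), ((p : ℕ) : 𝓞 K) ∈ v.asIdeal → v ∈ S)
    (hS : ramificationSubgroup K S ≤ (AnticyclotomicBigGaloisRep κ ρ).ker)
    {𝔭 𝔭bar : HeightOneSpectrum (𝓞 K)} (h𝔭 : ((p : ℕ) : 𝓞 K) ∈ 𝔭.asIdeal)
    (h𝔭bar : ((p : ℕ) : 𝓞 K) ∈ 𝔭bar.asIdeal) (hne : 𝔭bar ≠ 𝔭)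
    (hLOC1𝔭 : LOC1 S (TelescopeK2RepDescent.descendUnramified S (AnticyclotomicBigGaloisRep κ ρ) hS) (Sum.inr 𝔭))
    (hLOC1𝔭bar : LOC1 S (TelescopeK2RepDescent.descendUnramified S (AnticyclotomicBigGaloisRep κ ρ) hS)
      (Sum.inr 𝔭bar))
    (h0 : HasCorank (IwasawaAlgebra₂ p) ((localRep S
      (TelescopeK2RepDescent.descendUnramified S (AnticyclotomicBigGaloisRep κ ρ) hS) (Sum.inr 𝔭bar)).H 0) 0)
    (hcot : ∀ w ∈ S, ((p : ℕ) : 𝓞 K) ∉ w.asIdeal →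
      IsCotorsion (IwasawaAlgebra₂ p) ((localRep S
        (TelescopeK2RepDescent.descendUnramified S (AnticyclotomicBigGaloisRep κ ρ) hS) (Sum.inr w)).H 1))
    {s : IwasawaAlgebra₂ p} (hs : ¬ (C (X : IwasawaAlgebra p) : IwasawaAlgebra₂ p) ∣ s)
    (hsX : ∀ x : XBig κ ρ 𝔭bar (∅ : Set (HeightOneSpectrum (𝓞 K))), s • x = 0) :
    ∀ P' : Submodule (IwasawaAlgebra₂ p) (XBig κ ρ 𝔭bar (∅ : Set (HeightOneSpectrum (𝓞 K)))),
      Module.IsPseudoNull (IwasawaAlgebra₂ p) ↥P' →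
        ∃ n : ℕ, ∀ x ∈ P', (((p : ℕ) : IwasawaAlgebra₂ p) ^ n) • x = 0 := by
  haveI := hK.2
  have hTC : ∀ v : InfinitePlace K, v.IsComplex := fun v ↦ IsTotallyComplex.isComplex v
  have hr₂ := nrComplexPlaces_eq_one_of_isImaginaryQuadratic hK
  have hdeg : 𝔭bar.asIdeal.ramificationIdx ℤ * 𝔭bar.asIdeal.inertiaDeg ℤ = 1 :=
    (ncard_primesOver_eq_two_and_deg_one_of_ne hK.1 h𝔭 h𝔭bar hne).2 h𝔭bar
  have hA : ∀ a : A, ∃ k : ℕ, p ^ k • a = 0 := pPrimary_of_fd p hP htor θ₀ hθ hker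
  have hSig : ∀ w : HeightOneSpectrum (𝓞 K), w ∉ S →
      w ∉ (∅ : Set (HeightOneSpectrum (𝓞 K))) ∧ ((p : ℕ) : 𝓞 K) ∉ w.asIdeal :=
    fun w hw ↦ ⟨fun h ↦ h, fun h ↦ hw (hSp w h)⟩
  have hLOC1 : ∀ w ∈ S, w ≠ 𝔭bar → (((p : ℕ) : 𝓞 K) ∈ w.asIdeal ∨ w ∈ (∅ : Set (HeightOneSpectrum (𝓞 K)))) →
      LOC1 S (TelescopeK2RepDescent.descendUnramified S (AnticyclotomicBigGaloisRep κ ρ) hS) (Sum.inr w) := by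
    rintro w - hw (hpw | h)
    · rcases eq_or_eq_of_natCast_mem_of_ne hK.1 h𝔭 h𝔭bar hne hpw with rfl | rfl
      · exact hLOC1𝔭
      · exact absurd rfl hw
    · exact absurd h id
  have hcot' : ∀ w ∈ S, w ≠ 𝔭bar → ((p : ℕ) : 𝓞 K) ∉ w.asIdeal → w ∉ (∅ : Set (HeightOneSpectrum (𝓞 K))) →
      IsCotorsion (IwasawaAlgebra₂ p) ((localRep S
        (TelescopeK2RepDescent.descendUnramified S (AnticyclotomicBigGaloisRep κ ρ) hS) (Sum.inr w)).H 1) :=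
    fun w hw _ hpw _ ↦ hcot w hw hpw
  exact TelescopeK2PurityFactFree.forall_isPseudoNull_XBig_exists_pow_smul_eq_zero_factFree p κ ρ hA hcof S hSf
    hSp hS 𝔭bar (hSp _ h𝔭bar) h𝔭bar hdeg ∅ hSig hTC hr₂ 𝔭 (hSp _ h𝔭) h𝔭 (fun h ↦ hne h.symm) hLOC1 hLOC1𝔭bar
    h0 hcot' (ne_zero_of_not_C_X_dvd p hs) hsX

/-- **The same, with `N_S ≤ ker` discharged from «`ρ₂` unramified outside `S₀`»** (FD⁺ clause (unr′)) for any finite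
`S ⊇ S₀ ∪ {w ∣ p}` (tree: `TelescopeK2BigRepUnramified.ramificationSubgroup_le_ker_anticyclotomicBigGaloisRep`: every
`ℤ_p`-extension is unramified outside `p`).  The LOCAL rows are stated for the descended representation at the proof
term so obtained. [cite: Greenberg2006, p. 341 L6–10] [cite: Greenberg2016Selmer, Prop. 4.1.1 (c) p. 15] -/
theorem forall_isPseudoNull_XBig_exists_pow_smul_eq_zero_of_isUnramifiedOutside (hK : IsImaginaryQuadratic K)
    (κ : ZpExtension K p) (ρ : ContinuousRep (absoluteGaloisGroup K) (IwasawaAlgebra p) A)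
    (hcof : IsCofree (IwasawaAlgebra p) A)
    {P : Type*} [AddCommGroup P] [Module ℤ_[p] P] (hP : ∀ y : P, ∃ k : ℕ, ((p : ℤ_[p]) ^ k) • y = 0)
    (htor : ∀ a : A, ∃ n : ℕ, (X : PowerSeries ℤ_[p]) ^ n • a = 0)
    (θ₀ : Submodule.torsionBy (PowerSeries ℤ_[p]) A (X : PowerSeries ℤ_[p]) →+ P)
    (hθ : ∀ (c : ℤ_[p]) (a : Submodule.torsionBy (PowerSeries ℤ_[p]) A (X : PowerSeries ℤ_[p])),
      θ₀ (C c • a) = c • θ₀ a)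
    (hker : Finite θ₀.ker)
    {S₀ : Set (HeightOneSpectrum (𝓞 K))} (hunr : GaloisRep.IsUnramifiedOutside S₀ ρ)
    (S : Set (HeightOneSpectrum (𝓞 K))) (hSf : S.Finite)
    (hSsub : ∀ w : HeightOneSpectrum (𝓞 K), w ∉ S → w ∉ S₀ ∧ ((p : ℕ) : 𝓞 K) ∉ w.asIdeal)
    {𝔭 𝔭bar : HeightOneSpectrum (𝓞 K)} (h𝔭 : ((p : ℕ) : 𝓞 K) ∈ 𝔭.asIdeal)
    (h𝔭bar : ((p : ℕ) : 𝓞 K) ∈ 𝔭bar.asIdeal) (hne : 𝔭bar ≠ 𝔭)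
    (hLOC1𝔭 : LOC1 S (TelescopeK2RepDescent.descendUnramified S (AnticyclotomicBigGaloisRep κ ρ)
      (TelescopeK2BigRepUnramified.ramificationSubgroup_le_ker_anticyclotomicBigGaloisRep κ ρ hunr S hSsub))
      (Sum.inr 𝔭))
    (hLOC1𝔭bar : LOC1 S (TelescopeK2RepDescent.descendUnramified S (AnticyclotomicBigGaloisRep κ ρ)
      (TelescopeK2BigRepUnramified.ramificationSubgroup_le_ker_anticyclotomicBigGaloisRep κ ρ hunr S hSsub))
      (Sum.inr 𝔭bar))
    (h0 : HasCorank (IwasawaAlgebra₂ p) ((localRep S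
      (TelescopeK2RepDescent.descendUnramified S (AnticyclotomicBigGaloisRep κ ρ)
        (TelescopeK2BigRepUnramified.ramificationSubgroup_le_ker_anticyclotomicBigGaloisRep κ ρ hunr S hSsub))
      (Sum.inr 𝔭bar)).H 0) 0)
    (hcot : ∀ w ∈ S, ((p : ℕ) : 𝓞 K) ∉ w.asIdeal →
      IsCotorsion (IwasawaAlgebra₂ p) ((localRep S
        (TelescopeK2RepDescent.descendUnramified S (AnticyclotomicBigGaloisRep κ ρ)
          (TelescopeK2BigRepUnramified.ramificationSubgroup_le_ker_anticyclotomicBigGaloisRep κ ρ hunr S hSsub))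
        (Sum.inr w)).H 1))
    {s : IwasawaAlgebra₂ p} (hs : ¬ (C (X : IwasawaAlgebra p) : IwasawaAlgebra₂ p) ∣ s)
    (hsX : ∀ x : XBig κ ρ 𝔭bar (∅ : Set (HeightOneSpectrum (𝓞 K))), s • x = 0) :
    ∀ P' : Submodule (IwasawaAlgebra₂ p) (XBig κ ρ 𝔭bar (∅ : Set (HeightOneSpectrum (𝓞 K)))),
      Module.IsPseudoNull (IwasawaAlgebra₂ p) ↥P' →
        ∃ n : ℕ, ∀ x ∈ P', (((p : ℕ) : IwasawaAlgebra₂ p) ^ n) • x = 0 :=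
  forall_isPseudoNull_XBig_exists_pow_smul_eq_zero_docked p hK κ ρ hcof hP htor θ₀ hθ hker S hSf
    (fun v hv ↦ by_contra fun h ↦ (hSsub v h).2 hv) _ h𝔭 h𝔭bar hne hLOC1𝔭 hLOC1𝔭bar h0 hcot hs hsX

end Summit.BirchSwinnertonDyer.BirchSwinnertonDyer.Theorems.TelescopeK2PurityDocked

end
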